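import Summits.Ventures.HodgeRepro.Night3FaceClosureGSetFull

/-!
# «S4 on one face per Galois-twist class ⟹ S4» on the `(G, c)` model: the twist reduction

Blind re-derivation cell `pub-hodge-repro`, seat `night-3` (gen 3).  Imports night-3's `Night3FaceClosureGSetFull`
(`alg_of_faces_gset_full`: S4 on EVERY census face `faceCornersMul c Φ p p'` ⟹ S4, Lemma L and the combinatorics in the
kernel) and, through it, typer's `Primitive` (`rmul Φ g = Φ·g`, the right translation) and `Faces`.  Namespace
`HodgeRepro.Night3.GSet`.

The route counts the open instances of S4 in GALOIS-TWIST CLASSES of faces (ROUTE.md §3.1: «`twist` (right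
translation) identifies Galois-conjugate faces»; the sealed rows: «the type squares form exactly the displayed number of
orbits under the Galois twists»): `A_{T·g}` is the complex torus `A_T` with `F` acting through the automorphism `g`
(the sealed `FaceCensusEngine.lean` L25–L26), so the corner products `B_M` and `B_{M·g}` are the same abelian variety with
the same `ι(F) ⊂ End⁰`, and «`W_F(B_{M·g})` algebraic» ⟺ «`W_F(B_M)` algebraic».  Here that symmetry is the HYPOTHESIS
`htwist : ∀ M g, Alg M → Alg (twistMul M g)` on the predicate, and the theorem says: with it, S4 is needed on ONE face
per twist class only (`alg_of_faces_gset_twist`; census form `alg_of_faces_gset_reps` — `Alg` on a finite set `R` of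
representatives, every face a twist of a member of `R`).  The combinatorial content is that right translation carries
faces to faces corner by corner (`faceCornersMul_rmul`).  Nothing here closes S4: the representatives' S4 stays a
hypothesis; no sealed file is touched; no Tier-2 item depends on this file.
-/

set_option autoImplicit false

namespace HodgeRepro.Night3.GSet

open Finset
open scoped Pointwise symmDiff

variable {G : Type*} [Group G]

/-! ### The right twist of a multiset of types -/

/-- The Galois twist of a multiset of CM types by `g`: every member right-translated, `M·g = {T·g : T ∈ M}`. -/
def twistMul (M : Multiset (Finset G)) (g : G) : Multiset (Finset G) := M.map fun T => rmul T g

/-- Twisting by `1` is the identity. -/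
theorem twistMul_one (M : Multiset (Finset G)) : twistMul M 1 = M := by
  simp [twistMul, rmul_one]

/-- Twisting is a right action: `(M·g)·h = M·(g h)`. -/
theorem twistMul_twistMul (M : Multiset (Finset G)) (g h : G) :
    twistMul (twistMul M g) h = twistMul M (g * h) := by
  simp [twistMul, Multiset.map_map, rmul_rmul]

/-- Twisting by `g` then by `g⁻¹` is the identity. -/
theorem twistMul_inv_twistMul (M : Multiset (Finset G)) (g : G) : twistMul (twistMul M g) g⁻¹ = M := by
  rw [twistMul_twistMul, mul_inv_cancel, twistMul_one]

/-! ### Right translation carries places, flips and faces to places, flips and faces -/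

variable [DecidableEq G]

/-- The place of `p g` is the translate of the place of `p`. -/
theorem place_mul (c p g : G) : place c (p * g) = rmul (place c p) g := by
  ext x
  simp only [place, Finset.mem_insert, Finset.mem_singleton, mem_rmul]
  constructor
  · rintro (rfl | rfl)
    · left; simp
    · right; rw [mul_assoc, mul_inv_cancel_right]
  · rintro (h | h)
    · left; rw [← h, inv_mul_cancel_right]
    · right; rw [← mul_assoc, ← h, inv_mul_cancel_right]

/-- `p' g` lies in the place of `p g` iff `p'` lies in the place of `p`. -/
theorem mul_mem_place_mul_iff (c p p' g : G) :
    p' * g ∈ place c (p * g) ↔ p' ∈ place c p := by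
  rw [place_mul, mem_rmul, mul_inv_cancel_right]

/-- Right translation commutes with the symmetric difference. -/
theorem rmul_symmDiff (S T : Finset G) (g : G) : rmul (S ∆ T) g = rmul S g ∆ rmul T g := by
  ext x
  simp only [mem_rmul, Finset.mem_symmDiff]

/-- The flip at `p g` of the translate is the translate of the flip at `p`. -/
theorem flipAt_mul_rmul (c p g : G) (S : Finset G) :
    flipAt c (p * g) (rmul S g) = rmul (flipAt c p S) g := by
  rw [flipAt, flipAt, place_mul, rmul_symmDiff]

/-- **Twists carry faces to faces**: the corners of the twisted face `(Φ·g; p g, p' g)` are the twisted corners of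
`(Φ; p, p')`. -/
theorem faceCornersMul_rmul (c : G) (Φ : Finset G) (p p' g : G) :
    faceCornersMul c (rmul Φ g) (p * g) (p' * g) = twistMul (faceCornersMul c Φ p p') g := by
  simp only [faceCornersMul, twistMul, Multiset.insert_eq_cons, Multiset.map_cons, Multiset.map_singleton,
    smul_rmul, flipAt_mul_rmul]

/-! ### The twist reduction -/

variable [Fintype G]

/-- **«S4 on one face per twist class ⟹ S4»** on the `(G, c)` model: `Alg` a predicate on multisets of CM types with
`hadd` / `hcancel` (Lemma P), `hpair` (Lefschetz (1,1)), `htwist` (Galois twists preserve `Alg`: `B_{M·g} = B_M` with `F`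
acting through `g`) and `hrep` (for every face SOME twist of it satisfies `Alg`); then `Alg` holds on every zero-sum
multiset.  The combinatorics is `faceCornersMul_rmul`; the closure is `alg_of_faces_gset_full`. -/
theorem alg_of_faces_gset_twist {c : G} (hc : IsComplexConj c) (Alg : Multiset (Finset G) → Prop)
    (hadd : ∀ M N, IsZeroSumG c M → IsZeroSumG c N → Alg M → Alg N → Alg (M + N))
    (hcancel : ∀ M N, IsZeroSumG c M → IsZeroSumG c N → Alg (M + N) → Alg N → Alg M)
    (hpair : ∀ Φ, IsCMType c Φ → Alg {Φ, c • Φ})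
    (htwist : ∀ M g, Alg M → Alg (twistMul M g))
    (hrep : ∀ Φ p p', IsCMType c Φ → p' ∉ place c p →
      ∃ g, Alg (faceCornersMul c (rmul Φ g) (p * g) (p' * g)))
    (M : Multiset (Finset G)) (hM : IsZeroSumG c M) : Alg M := by
  refine alg_of_faces_gset_full hc Alg hadd hcancel hpair ?_ M hM
  intro Φ p p' hΦ hp
  obtain ⟨g, hg⟩ := hrep Φ p p' hΦ hp
  rw [faceCornersMul_rmul] at hg
  have := htwist _ g⁻¹ hg
  rwa [twistMul_inv_twistMul] at this

/-- **Census form**: `R` a finite set of multisets (the corner multisets of the census representatives), `hR` (S4 on the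
members of `R`), `hcover` (every face is a twist of a member of `R`); with `hadd` / `hcancel` / `hpair` / `htwist` as
above, `Alg` holds on every zero-sum multiset. -/
theorem alg_of_faces_gset_reps {c : G} (hc : IsComplexConj c) (Alg : Multiset (Finset G) → Prop)
    (hadd : ∀ M N, IsZeroSumG c M → IsZeroSumG c N → Alg M → Alg N → Alg (M + N))
    (hcancel : ∀ M N, IsZeroSumG c M → IsZeroSumG c N → Alg (M + N) → Alg N → Alg M)
    (hpair : ∀ Φ, IsCMType c Φ → Alg {Φ, c • Φ})
    (htwist : ∀ M g, Alg M → Alg (twistMul M g))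
    (R : Finset (Multiset (Finset G))) (hR : ∀ N ∈ R, Alg N)
    (hcover : ∀ Φ p p', IsCMType c Φ → p' ∉ place c p →
      ∃ N ∈ R, ∃ g, faceCornersMul c Φ p p' = twistMul N g)
    (M : Multiset (Finset G)) (hM : IsZeroSumG c M) : Alg M := by
  refine alg_of_faces_gset_full hc Alg hadd hcancel hpair ?_ M hM
  intro Φ p p' hΦ hp
  obtain ⟨N, hN, g, hg⟩ := hcover Φ p p' hΦ hp
  rw [hg]
  exact htwist N g (hR N hN)

end HodgeRepro.Night3.GSet
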